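import Summits.HubbardSuperconductivity.HubbardSuperconductivity.Theorems.KLProgrammeKLRegimeScaleZeroWeightedSizesShape

/-!
# Route `KLProgramme`, crux K3 — engine-flow child (stmt-HubbardSuperconductivity-20437), stub (C) at `n = 0`, located brick «A-SIZES-WEIGHTED» (pen (R181)),
# brick 4e (ii): THE WEIGHTED ROW/COLUMN SIZES `hrow/hcol` of `S_{4M}ᵀ C⁰_{>e₀} S_{4M}` with the tree weight `(1 + λ·diam)^k` — β-, M-, L-uniform constants

Cell gate-hubbard-kl, seat p1 g21.  The hypotheses `hrow/hcol` of p1 g18's `twoLeg_offDiag_moment_pow_sum_tail3_frameZero_le(_booked)` (…ScaleZeroTwoLegTail3 /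
…Tail3OnSite), i.e. `Σ_Y ‖C X Y‖·(1+λ·d(X,Y))^k ≤ a·4M/β` for the pair value `d = gridLabelDist` (periodic time distance + torus `ℓ^∞` distance), from the
decay shape of brick 4e (i) (`norm_gridCov_apply_le_decayShape`) and the core lemma of brick 4d (`weightedGridSum_le_of_decayShape`):

* §2 `gridCov_apply_eq_zero_of_charge_eq_or_spin_ne`, `norm_gridCov_apply_comm`, `diamWeight_gridLegPos_pair`; **`rowSum_scaleZero_weighted_le`**,
  **`colSum_scaleZero_weighted_le`** — for `μ ∈ klWindowC`, `klBetaMin ≤ β`, `klEngL₃ β U ≤ L`, `2k+5 ≤ M`, `ℓ > 0`, `0 ≤ λ ≤ 1`, `λℓ ≤ 1`: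
  `Σ_Y ‖C X Y‖·wt_{λ,k}{X,Y} ≤ 2(1+β)^k(1+log 4M)·(EDon_k + EDoff_k·S₄) + 2(1+4Mℓ/β)·2^{k+2}(max(16, BKon_k/ℓ^{k+2}) + max(Goff_k, BKoff_k/ℓ^{k+2})·S₄)`;
* §3 `weightedSize_currency`, **`rowSum_scaleZero_weighted_le_size`** / **`colSum_…`** — the `a·(2(2M))/β` currency under `β ≤ 4M`, `2β(1+β)^k(1+log 4M) ≤ 4M`:
  `a_k(ℓ) = (EDon_k + EDoff_k S₄) + 2(1+ℓ)·2^{k+2}(max(16, BKon_k/ℓ^{k+2}) + max(Goff_k, BKoff_k/ℓ^{k+2})·S₄)` — `β`-, `M`-, `L`-, `μ`-, `U`-free, any `ℓ > 0`;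
* §4 `weightedSize_sideConditions_of_klEng` (`klEngM₃ ≤ M ⇒ M ≥ 2³⁰(1+β)⁶ ⇒` the side conditions for `k ≤ 4`), **`rowSum_scaleZero_weighted_le_klEng`** /
  **`colSum_scaleZero_weighted_le_klEng`** — `hrow/hcol` under exactly the engine's binders.

Honest size (not a theorem): these analytic constants are astronomically larger than the true moments (factorials × cutoff table × `(π/e₀)^{k+2}`); the
decay-length knob `ℓ` with `λ = 1/ℓ` trades `(π/e₀)^{k+2}` in `a_k` for `(2ℓ)^k` in the booked tail row.  Proofs only; no definitions; nothing here asserts (C),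
any stub of 20437, K3 or superconductivity.
References: BGM 2006 §2.2 (2.36aa), §2.4 (2.77)–(2.80) [cite: BenfattoGiulianiMastropietro2006]; de Siqueira Pedra–Salmhofer 2008 §4 Cor. 4.4 [cite: PedraSalmhofer2008].
-/

noncomputable section

namespace Summit.HubbardSuperconductivity.HubbardSuperconductivity.Theorems.KLRegimeSplit

set_option linter.dupNamespace false -- summit = problem name (single-conjunct summit), D-0017

open Literature.MathematicalPhysics.QuantumLattice Literature.Probability.LatticeModels Literature.Analysis.FunctionSpaces
open Literature.Probability.LatticeModels.BattleFederbush
open Summit.HubbardSuperconductivity.HubbardSuperconductivity.Theorems.DispersionFlow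
open Summit.HubbardSuperconductivity.HubbardSuperconductivity.Theorems.EngineV8 (gridLabelDist gridLegPos gridLabelDist_apply gridLegPos_apply
  isLabelDist_gridLabelDist klEngL₃)
open Finset Real
open scoped Nat

variable {L M : ℕ} [NeZero L] [NeZero M]

/-! ## §2 The weighted row and column sums -/

omit [NeZero M] in
/-- Entries with equal charges or different spins vanish (the `normalCovariance` structure of the bare-frame covariance). -/
theorem gridCov_apply_eq_zero_of_charge_eq_or_spin_ne (β μ Λ : ℝ) (K : TrigPolyC4v) (N : ℕ) {X Y : GridLeg (GridPoint L N)}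
    (h : Y.2 = X.2 ∨ Y.1.2 ≠ X.1.2) :
    ((hubbardGridSub L M β N).transpose * hubbardCovAboveCT L M β μ 0 K Λ * hubbardGridSub L M β N) X Y = 0 := by
  rw [hubbardCovAboveCT_zero_seed_eq_normalCovariance_uvSymbolCT, hubbardGridSub]
  rcases h with hc | hs
  · exact gridSub_pullback_normalCovariance_apply_of_charge_eq β _ _ _ hc.symm
  · exact gridSub_pullback_normalCovariance_apply_of_spin_ne β _ _ _ (Ne.symm hs)

omit [NeZero M] in
/-- `‖C X Y‖ = ‖C Y X‖` (antisymmetry). -/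
theorem norm_gridCov_apply_comm (β μ Λ : ℝ) (K : TrigPolyC4v) (N : ℕ) (X Y : GridLeg (GridPoint L N)) :
    ‖((hubbardGridSub L M β N).transpose * hubbardCovAboveCT L M β μ 0 K Λ * hubbardGridSub L M β N) X Y‖ =
      ‖((hubbardGridSub L M β N).transpose * hubbardCovAboveCT L M β μ 0 K Λ * hubbardGridSub L M β N) Y X‖ := by
  have h := congrFun (congrFun (gridCov_hubbardCovAboveCT_transpose (L := L) (M := M) β μ Λ K N) Y) X
  rw [Matrix.transpose_apply, Matrix.neg_apply] at h
  rw [h, norm_neg]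

/-- The pair weight of the scale-`0` bookkeeping, read on grid legs: `wt{X,Y} = (1 + λ·(β/N·cyclicDist(j_X,j_Y) + torusSiteDist(x_X,x_Y)))^k`. -/
theorem diamWeight_gridLegPos_pair {β : ℝ} (hβ : 0 ≤ β) {N : ℕ} [NeZero N] (lam : ℝ) (k : ℕ) (X Y : GridLeg (GridPoint L N)) :
    diamWeight (fun s => (1 + lam * s) ^ k) (gridLabelDist L N β) {gridLegPos X, gridLegPos Y} =
      (1 + lam * (β / N * cyclicDist N (((X.1.1.1 : ℕ) : ZMod N)) (((Y.1.1.1 : ℕ) : ZMod N)) + torusSiteDist X.1.1.2 Y.1.1.2)) ^ k := by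
  rw [diamWeight, labelDiam_pair (isLabelDist_gridLabelDist L N hβ), gridLegPos_apply, gridLegPos_apply, gridLabelDist_apply]

/-- **THE WEIGHTED ROW SUM** (bare frame; `μ ∈ klWindowC`, `klBetaMin ≤ β`, `klEngL₃ β U ≤ L`, `2k+5 ≤ M`, `ℓ > 0`, `0 ≤ λ ≤ 1`, `λℓ ≤ 1`):
`Σ_Y ‖C X Y‖·wt_{λ,k}{X,Y} ≤ 2(1+β)^k(1+log 4M)·(EDon + EDoff·S₄) + 2(1+4Mℓ/β)·(G′on + G′off·S₄)` with the explicit constants of `norm_gridCov_apply_le_decayShape`. -/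
theorem rowSum_scaleZero_weighted_le {μ : ℝ} (hμ : μ ∈ klWindowC) {β U : ℝ} (hβ : klBetaMin ≤ β) (hL : klEngL₃ β U ≤ L) (k : ℕ)
    (hM : 2 * (k + 2) + 1 ≤ M) {ℓ : ℝ} (hℓ : 0 < ℓ) {lam : ℝ} (hlam0 : 0 ≤ lam) (hlam1 : lam ≤ 1) (hlamℓ : lam * ℓ ≤ 1)
    (X : GridLeg (GridPoint L (2 * (2 * M)))) :
    let Aon : ℕ → ℝ := fun i => klChi2CauchyTab (k + 2) * (i + 1) ! * 2 ^ (i + 1)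
    let Aoff : ℕ → ℝ := fun i => (k + 4) ! * klChi2CauchyTab (i + (k + 4)) * (i + (k + 4) + 1) ! * 2 ^ (i + 2) * (2 / klE0) *
      (max 1 (4 / klE0)) ^ (k + 4 - 1) * 8 ^ (k + 4) * (1 + (4 : ℝ) ^ (k + 4) * ∑' q : Site 2, ((1 + ‖q‖) ^ (k + 4))⁻¹)
    let Goff : ℝ := 4 * ((k + 4) ! * klChi2CauchyTab (k + 4) * (k + 4 + 1) ! * (max 1 (4 / klE0)) ^ (k + 4 - 1) * 8 ^ (k + 4) *
      (1 + (4 : ℝ) ^ (k + 4) * ∑' q : Site 2, ((1 + ‖q‖) ^ (k + 4))⁻¹)) * (2 / klE0)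
    let EDon : ℝ := ∑ i ∈ Finset.range (k + 2), 2 * ((max i 1 : ℕ) : ℝ) * 2 ^ i * Aon i / π
    let EDoff : ℝ := ∑ i ∈ Finset.range (k + 2), 2 * ((max i 1 : ℕ) : ℝ) * 2 ^ i * Aoff i / π
    let Gon' : ℝ := max 16 ((k + 2 : ℕ) * Aon (k + 2) * (π / klE0) ^ (k + 2) / ℓ ^ (k + 2)) * 2 ^ (k + 2)
    let Goff' : ℝ := max Goff ((k + 2 : ℕ) * Aoff (k + 2) * (π / klE0) ^ (k + 2) / ℓ ^ (k + 2)) * 2 ^ (k + 2)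
    ∑ Y : GridLeg (GridPoint L (2 * (2 * M))),
        ‖((hubbardGridSub L M β (2 * (2 * M))).transpose * hubbardCovAboveCT L M β μ 0 0 klE0 * hubbardGridSub L M β (2 * (2 * M))) X Y‖ *
          diamWeight (fun s => (1 + lam * s) ^ k) (gridLabelDist L (2 * (2 * M)) β) {gridLegPos X, gridLegPos Y} ≤
      2 * (1 + β) ^ k * (1 + Real.log (((2 * (2 * M) : ℕ) : ℝ))) * (EDon + EDoff * ∑' z : Site 2, ((1 + ‖z‖) ^ 4)⁻¹) +
        2 * (1 + ℓ * (((2 * (2 * M) : ℕ) : ℝ)) / β) * (Gon' + Goff' * ∑' z : Site 2, ((1 + ‖z‖) ^ 4)⁻¹) := by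
  intro Aon Aoff Goff EDon EDoff Gon' Goff'
  haveI : NeZero (2 * (2 * M)) := ⟨by have := NeZero.ne M; omega⟩
  have hβ0 : 0 < β := lt_of_lt_of_le (by norm_num [klBetaMin]) hβ
  have hS0 : ∀ m : ℕ, 0 ≤ ∑' q : Site 2, ((1 + ‖q‖) ^ m)⁻¹ := fun m => tsum_nonneg fun _ => by positivity
  have hT0 : ∀ m : ℕ, 0 ≤ klChi2CauchyTab m := fun m => zero_le_one.trans (one_le_klChi2CauchyTab m)
  have hE0 : (0 : ℝ) < klE0 := by norm_num [klE0]
  have hAon0 : ∀ i, 0 ≤ Aon i := fun i => by simp only [Aon]; have := hT0 (k + 2); positivity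
  have hAoff0 : ∀ i, 0 ≤ Aoff i := fun i => by simp only [Aoff]; have := hT0 (i + (k + 4)); have := hS0 (k + 4); positivity
  have hGoff0 : 0 ≤ Goff := by simp only [Goff]; have := hT0 (k + 4); have := hS0 (k + 4); positivity
  have hEDon0 : 0 ≤ EDon := Finset.sum_nonneg fun i _ => by have := hAon0 i; positivity
  have hEDoff0 : 0 ≤ EDoff := Finset.sum_nonneg fun i _ => by have := hAoff0 i; positivity
  have hGon'0 : 0 ≤ Gon' := mul_nonneg (le_max_of_le_left (by norm_num)) (pow_nonneg (by norm_num) _)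
  have hGoff'0 : 0 ≤ Goff' := mul_nonneg (le_max_of_le_left hGoff0) (pow_nonneg (by norm_num) _)
  obtain ⟨⟨p, σ⟩, c⟩ := X
  set C := (hubbardGridSub L M β (2 * (2 * M))).transpose * hubbardCovAboveCT L M β μ 0 0 klE0 * hubbardGridSub L M β (2 * (2 * M)) with hC
  -- only the legs `((b, σ), 1 - c)` contribute
  have hsum : ∑ Y : GridLeg (GridPoint L (2 * (2 * M))), ‖C ((p, σ), c) Y‖ *
        diamWeight (fun s => (1 + lam * s) ^ k) (gridLabelDist L (2 * (2 * M)) β) {gridLegPos ((p, σ), c), gridLegPos Y} =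
      ∑ b : GridPoint L (2 * (2 * M)), ‖C ((p, σ), c) ((b, σ), 1 - c)‖ *
        (1 + lam * (β / ((2 * (2 * M) : ℕ) : ℝ) * cyclicDist (2 * (2 * M)) (((p.1 : ℕ) : ZMod (2 * (2 * M)))) (((b.1 : ℕ) : ZMod (2 * (2 * M)))) +
          torusSiteDist p.2 b.2)) ^ k := by
    rw [Fintype.sum_prod_type, Fintype.sum_prod_type]
    refine Finset.sum_congr rfl fun b _ => ?_
    rw [Fintype.sum_eq_single σ fun σ' hσ' => ?_, Fintype.sum_eq_single (1 - c) fun c'' hc'' => ?_]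
    · rw [diamWeight_gridLegPos_pair hβ0.le]
    · have hcc : ((b, σ), c'').2 = (((p, σ), c) : GridLeg (GridPoint L (2 * (2 * M)))).2 := by
        show c'' = c
        fin_cases c <;> fin_cases c'' <;> simp_all
      rw [hC, gridCov_apply_eq_zero_of_charge_eq_or_spin_ne β μ klE0 0 _ (Or.inl hcc), norm_zero, zero_mul]
    · exact Finset.sum_eq_zero fun c'' _ => by
        rw [hC, gridCov_apply_eq_zero_of_charge_eq_or_spin_ne β μ klE0 0 _ (Or.inr hσ'), norm_zero, zero_mul]
  rw [hsum]
  -- the pointwise decay shape for `F b = ‖C ((p,σ),c) ((b,σ),1-c)‖` in either orientation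
  refine weightedGridSum_le_of_decayShape (L := L) (N := 2 * (2 * M)) hβ0 hℓ hlam0 hlam1 hlamℓ k p hEDon0 hEDoff0 hGon'0 hGoff'0
    (fun b => ‖C ((p, σ), c) ((b, σ), 1 - c)‖) fun b => ?_
  have hshape := norm_gridCov_apply_le_decayShape (L := L) (M := M) hμ hβ hL k hM hℓ σ p b
  fin_cases c
  · simp only [Fin.zero_eta, Fin.isValue, sub_zero]
    exact hshape.1
  · simp only [Fin.mk_one, Fin.isValue, sub_self]
    rw [hC, norm_gridCov_apply_comm]
    exact hshape.2

/-- **THE WEIGHTED COLUMN SUM** (same bound; antisymmetry and the symmetry of the pair weight). -/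
theorem colSum_scaleZero_weighted_le {μ : ℝ} (hμ : μ ∈ klWindowC) {β U : ℝ} (hβ : klBetaMin ≤ β) (hL : klEngL₃ β U ≤ L) (k : ℕ)
    (hM : 2 * (k + 2) + 1 ≤ M) {ℓ : ℝ} (hℓ : 0 < ℓ) {lam : ℝ} (hlam0 : 0 ≤ lam) (hlam1 : lam ≤ 1) (hlamℓ : lam * ℓ ≤ 1)
    (Y : GridLeg (GridPoint L (2 * (2 * M)))) :
    let Aon : ℕ → ℝ := fun i => klChi2CauchyTab (k + 2) * (i + 1) ! * 2 ^ (i + 1)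
    let Aoff : ℕ → ℝ := fun i => (k + 4) ! * klChi2CauchyTab (i + (k + 4)) * (i + (k + 4) + 1) ! * 2 ^ (i + 2) * (2 / klE0) *
      (max 1 (4 / klE0)) ^ (k + 4 - 1) * 8 ^ (k + 4) * (1 + (4 : ℝ) ^ (k + 4) * ∑' q : Site 2, ((1 + ‖q‖) ^ (k + 4))⁻¹)
    let Goff : ℝ := 4 * ((k + 4) ! * klChi2CauchyTab (k + 4) * (k + 4 + 1) ! * (max 1 (4 / klE0)) ^ (k + 4 - 1) * 8 ^ (k + 4) *
      (1 + (4 : ℝ) ^ (k + 4) * ∑' q : Site 2, ((1 + ‖q‖) ^ (k + 4))⁻¹)) * (2 / klE0)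
    let EDon : ℝ := ∑ i ∈ Finset.range (k + 2), 2 * ((max i 1 : ℕ) : ℝ) * 2 ^ i * Aon i / π
    let EDoff : ℝ := ∑ i ∈ Finset.range (k + 2), 2 * ((max i 1 : ℕ) : ℝ) * 2 ^ i * Aoff i / π
    let Gon' : ℝ := max 16 ((k + 2 : ℕ) * Aon (k + 2) * (π / klE0) ^ (k + 2) / ℓ ^ (k + 2)) * 2 ^ (k + 2)
    let Goff' : ℝ := max Goff ((k + 2 : ℕ) * Aoff (k + 2) * (π / klE0) ^ (k + 2) / ℓ ^ (k + 2)) * 2 ^ (k + 2)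
    ∑ X : GridLeg (GridPoint L (2 * (2 * M))),
        ‖((hubbardGridSub L M β (2 * (2 * M))).transpose * hubbardCovAboveCT L M β μ 0 0 klE0 * hubbardGridSub L M β (2 * (2 * M))) X Y‖ *
          diamWeight (fun s => (1 + lam * s) ^ k) (gridLabelDist L (2 * (2 * M)) β) {gridLegPos X, gridLegPos Y} ≤
      2 * (1 + β) ^ k * (1 + Real.log (((2 * (2 * M) : ℕ) : ℝ))) * (EDon + EDoff * ∑' z : Site 2, ((1 + ‖z‖) ^ 4)⁻¹) +
        2 * (1 + ℓ * (((2 * (2 * M) : ℕ) : ℝ)) / β) * (Gon' + Goff' * ∑' z : Site 2, ((1 + ‖z‖) ^ 4)⁻¹) := by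
  intro Aon Aoff Goff EDon EDoff Gon' Goff'
  have h := rowSum_scaleZero_weighted_le (L := L) (M := M) hμ hβ hL k hM hℓ hlam0 hlam1 hlamℓ Y
  refine le_trans (le_of_eq (Finset.sum_congr rfl fun X _ => ?_)) h
  rw [norm_gridCov_apply_comm, Finset.pair_comm]

/-! ## §3 The `a·(2(2M))/β` currency of `hrow/hcol` -/

omit [NeZero L] [NeZero M] in
/-- Currency conversion: `2(1+β)^k(1+log N)·X + 2(1+ℓN/β)·Y ≤ (X + 2(1+ℓ)Y)·N/β` when `β ≤ N` and `2β(1+β)^k(1+log N) ≤ N` (`X, Y ≥ 0`). -/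
theorem weightedSize_currency {β ℓ Nr X Y : ℝ} {k : ℕ} (hβ : 0 < β) (hX : 0 ≤ X) (hY : 0 ≤ Y) (hβN : β ≤ Nr)
    (hlog : 2 * β * (1 + β) ^ k * (1 + Real.log Nr) ≤ Nr) :
    2 * (1 + β) ^ k * (1 + Real.log Nr) * X + 2 * (1 + ℓ * Nr / β) * Y ≤ (X + 2 * (1 + ℓ) * Y) * Nr / β := by
  have h1 : 2 * (1 + β) ^ k * (1 + Real.log Nr) ≤ Nr / β := by
    rw [le_div_iff₀ hβ]; linarith
  have h2 : 2 * (1 + ℓ * Nr / β) ≤ 2 * (1 + ℓ) * (Nr / β) := by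
    have : 1 ≤ Nr / β := by rw [le_div_iff₀ hβ, one_mul]; exact hβN
    have key : 2 * (1 + ℓ) * (Nr / β) - 2 * (1 + ℓ * Nr / β) = 2 * (Nr / β - 1) := by ring
    linarith
  calc 2 * (1 + β) ^ k * (1 + Real.log Nr) * X + 2 * (1 + ℓ * Nr / β) * Y ≤ Nr / β * X + 2 * (1 + ℓ) * (Nr / β) * Y :=
        add_le_add (mul_le_mul_of_nonneg_right h1 hX) (mul_le_mul_of_nonneg_right h2 hY)
    _ = (X + 2 * (1 + ℓ) * Y) * Nr / β := by ring

/-- **`hrow` IN THE CURRENCY OF `twoLeg_offDiag_moment_pow_sum_tail3_frameZero_le(_booked)`**: under `μ ∈ klWindowC`, `klBetaMin ≤ β`, `klEngL₃ β U ≤ L`,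
`2k+5 ≤ M`, `β ≤ 4M`, `2β(1+β)^k(1+log 4M) ≤ 4M`, `ℓ > 0`, `0 ≤ λ ≤ 1`, `λℓ ≤ 1`:
`Σ_Y ‖C X Y‖·wt_{λ,k}{X,Y} ≤ a·(2(2M))/β`, `a = (EDon + EDoff·S₄) + 2(1+ℓ)·(G′on + G′off·S₄)` — β-, M-, L-, μ-, U-free. -/
theorem rowSum_scaleZero_weighted_le_size {μ : ℝ} (hμ : μ ∈ klWindowC) {β U : ℝ} (hβ : klBetaMin ≤ β) (hL : klEngL₃ β U ≤ L) (k : ℕ)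
    (hM : 2 * (k + 2) + 1 ≤ M) (hβN : β ≤ ((2 * (2 * M) : ℕ) : ℝ))
    (hlog : 2 * β * (1 + β) ^ k * (1 + Real.log (((2 * (2 * M) : ℕ) : ℝ))) ≤ ((2 * (2 * M) : ℕ) : ℝ))
    {ℓ : ℝ} (hℓ : 0 < ℓ) {lam : ℝ} (hlam0 : 0 ≤ lam) (hlam1 : lam ≤ 1) (hlamℓ : lam * ℓ ≤ 1) (X : GridLeg (GridPoint L (2 * (2 * M)))) :
    let Aon : ℕ → ℝ := fun i => klChi2CauchyTab (k + 2) * (i + 1) ! * 2 ^ (i + 1)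
    let Aoff : ℕ → ℝ := fun i => (k + 4) ! * klChi2CauchyTab (i + (k + 4)) * (i + (k + 4) + 1) ! * 2 ^ (i + 2) * (2 / klE0) *
      (max 1 (4 / klE0)) ^ (k + 4 - 1) * 8 ^ (k + 4) * (1 + (4 : ℝ) ^ (k + 4) * ∑' q : Site 2, ((1 + ‖q‖) ^ (k + 4))⁻¹)
    let Goff : ℝ := 4 * ((k + 4) ! * klChi2CauchyTab (k + 4) * (k + 4 + 1) ! * (max 1 (4 / klE0)) ^ (k + 4 - 1) * 8 ^ (k + 4) *
      (1 + (4 : ℝ) ^ (k + 4) * ∑' q : Site 2, ((1 + ‖q‖) ^ (k + 4))⁻¹)) * (2 / klE0)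
    let EDon : ℝ := ∑ i ∈ Finset.range (k + 2), 2 * ((max i 1 : ℕ) : ℝ) * 2 ^ i * Aon i / π
    let EDoff : ℝ := ∑ i ∈ Finset.range (k + 2), 2 * ((max i 1 : ℕ) : ℝ) * 2 ^ i * Aoff i / π
    let Gon' : ℝ := max 16 ((k + 2 : ℕ) * Aon (k + 2) * (π / klE0) ^ (k + 2) / ℓ ^ (k + 2)) * 2 ^ (k + 2)
    let Goff' : ℝ := max Goff ((k + 2 : ℕ) * Aoff (k + 2) * (π / klE0) ^ (k + 2) / ℓ ^ (k + 2)) * 2 ^ (k + 2)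
    let a : ℝ := (EDon + EDoff * ∑' z : Site 2, ((1 + ‖z‖) ^ 4)⁻¹) + 2 * (1 + ℓ) * (Gon' + Goff' * ∑' z : Site 2, ((1 + ‖z‖) ^ 4)⁻¹)
    ∑ Y : GridLeg (GridPoint L (2 * (2 * M))),
        ‖((hubbardGridSub L M β (2 * (2 * M))).transpose * hubbardCovAboveCT L M β μ 0 0 klE0 * hubbardGridSub L M β (2 * (2 * M))) X Y‖ *
          diamWeight (fun s => (1 + lam * s) ^ k) (gridLabelDist L (2 * (2 * M)) β) {gridLegPos X, gridLegPos Y} ≤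
      a * ((2 * (2 * M) : ℕ) : ℝ) / β := by
  intro Aon Aoff Goff EDon EDoff Gon' Goff' a
  have hβ0 : 0 < β := lt_of_lt_of_le (by norm_num [klBetaMin]) hβ
  have hS0 : ∀ m : ℕ, 0 ≤ ∑' q : Site 2, ((1 + ‖q‖) ^ m)⁻¹ := fun m => tsum_nonneg fun _ => by positivity
  have hT0 : ∀ m : ℕ, 0 ≤ klChi2CauchyTab m := fun m => zero_le_one.trans (one_le_klChi2CauchyTab m)
  have hE0 : (0 : ℝ) < klE0 := by norm_num [klE0]
  have hAon0 : ∀ i, 0 ≤ Aon i := fun i => by simp only [Aon]; have := hT0 (k + 2); positivity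
  have hAoff0 : ∀ i, 0 ≤ Aoff i := fun i => by simp only [Aoff]; have := hT0 (i + (k + 4)); have := hS0 (k + 4); positivity
  have hGoff0 : 0 ≤ Goff := by simp only [Goff]; have := hT0 (k + 4); have := hS0 (k + 4); positivity
  have hEDon0 : 0 ≤ EDon := Finset.sum_nonneg fun i _ => by have := hAon0 i; positivity
  have hEDoff0 : 0 ≤ EDoff := Finset.sum_nonneg fun i _ => by have := hAoff0 i; positivity
  have hGon'0 : 0 ≤ Gon' := mul_nonneg (le_max_of_le_left (by norm_num)) (pow_nonneg (by norm_num) _)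
  have hGoff'0 : 0 ≤ Goff' := mul_nonneg (le_max_of_le_left hGoff0) (pow_nonneg (by norm_num) _)
  have h := rowSum_scaleZero_weighted_le (L := L) (M := M) hμ hβ hL k hM hℓ hlam0 hlam1 hlamℓ X
  refine h.trans ?_
  have hc := weightedSize_currency (k := k) (ℓ := ℓ) hβ0 (add_nonneg hEDon0 (mul_nonneg hEDoff0 (hS0 4)))
    (add_nonneg hGon'0 (mul_nonneg hGoff'0 (hS0 4))) hβN hlog
  simpa only [a] using hc

/-- **`hcol` in the same currency.** -/
theorem colSum_scaleZero_weighted_le_size {μ : ℝ} (hμ : μ ∈ klWindowC) {β U : ℝ} (hβ : klBetaMin ≤ β) (hL : klEngL₃ β U ≤ L) (k : ℕ)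
    (hM : 2 * (k + 2) + 1 ≤ M) (hβN : β ≤ ((2 * (2 * M) : ℕ) : ℝ))
    (hlog : 2 * β * (1 + β) ^ k * (1 + Real.log (((2 * (2 * M) : ℕ) : ℝ))) ≤ ((2 * (2 * M) : ℕ) : ℝ))
    {ℓ : ℝ} (hℓ : 0 < ℓ) {lam : ℝ} (hlam0 : 0 ≤ lam) (hlam1 : lam ≤ 1) (hlamℓ : lam * ℓ ≤ 1) (Y : GridLeg (GridPoint L (2 * (2 * M)))) :
    let Aon : ℕ → ℝ := fun i => klChi2CauchyTab (k + 2) * (i + 1) ! * 2 ^ (i + 1)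
    let Aoff : ℕ → ℝ := fun i => (k + 4) ! * klChi2CauchyTab (i + (k + 4)) * (i + (k + 4) + 1) ! * 2 ^ (i + 2) * (2 / klE0) *
      (max 1 (4 / klE0)) ^ (k + 4 - 1) * 8 ^ (k + 4) * (1 + (4 : ℝ) ^ (k + 4) * ∑' q : Site 2, ((1 + ‖q‖) ^ (k + 4))⁻¹)
    let Goff : ℝ := 4 * ((k + 4) ! * klChi2CauchyTab (k + 4) * (k + 4 + 1) ! * (max 1 (4 / klE0)) ^ (k + 4 - 1) * 8 ^ (k + 4) *
      (1 + (4 : ℝ) ^ (k + 4) * ∑' q : Site 2, ((1 + ‖q‖) ^ (k + 4))⁻¹)) * (2 / klE0)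
    let EDon : ℝ := ∑ i ∈ Finset.range (k + 2), 2 * ((max i 1 : ℕ) : ℝ) * 2 ^ i * Aon i / π
    let EDoff : ℝ := ∑ i ∈ Finset.range (k + 2), 2 * ((max i 1 : ℕ) : ℝ) * 2 ^ i * Aoff i / π
    let Gon' : ℝ := max 16 ((k + 2 : ℕ) * Aon (k + 2) * (π / klE0) ^ (k + 2) / ℓ ^ (k + 2)) * 2 ^ (k + 2)
    let Goff' : ℝ := max Goff ((k + 2 : ℕ) * Aoff (k + 2) * (π / klE0) ^ (k + 2) / ℓ ^ (k + 2)) * 2 ^ (k + 2)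
    let a : ℝ := (EDon + EDoff * ∑' z : Site 2, ((1 + ‖z‖) ^ 4)⁻¹) + 2 * (1 + ℓ) * (Gon' + Goff' * ∑' z : Site 2, ((1 + ‖z‖) ^ 4)⁻¹)
    ∑ X : GridLeg (GridPoint L (2 * (2 * M))),
        ‖((hubbardGridSub L M β (2 * (2 * M))).transpose * hubbardCovAboveCT L M β μ 0 0 klE0 * hubbardGridSub L M β (2 * (2 * M))) X Y‖ *
          diamWeight (fun s => (1 + lam * s) ^ k) (gridLabelDist L (2 * (2 * M)) β) {gridLegPos X, gridLegPos Y} ≤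
      a * ((2 * (2 * M) : ℕ) : ℝ) / β := by
  intro Aon Aoff Goff EDon EDoff Gon' Goff' a
  have h := rowSum_scaleZero_weighted_le_size (L := L) (M := M) hμ hβ hL k hM hβN hlog hℓ hlam0 hlam1 hlamℓ Y
  refine le_trans (le_of_eq (Finset.sum_congr rfl fun X _ => ?_)) h
  rw [norm_gridCov_apply_comm, Finset.pair_comm]

/-! ## §4 The engine regime supplies the side conditions (`k ≤ 4`) -/

omit [NeZero L] [NeZero M] in
/-- **The regime binders give the side conditions**: `klBetaMin ≤ β`, `klEngL₃ β U ≤ L`, `klEngM₃ β U L ≤ M` imply `M ≥ 2³⁰(1+β)⁶`, hence for `k ≤ 4`: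
`2(k+2)+1 ≤ M`, `β ≤ 4M` and `2β(1+β)^k(1 + log 4M) ≤ 4M`. -/
theorem weightedSize_sideConditions_of_klEng {β U : ℝ} (hβ : klBetaMin ≤ β) (hL : klEngL₃ β U ≤ L) (hM : EngineV8.klEngM₃ β U L ≤ M)
    {k : ℕ} (hk : k ≤ 4) :
    2 * (k + 2) + 1 ≤ M ∧ β ≤ ((2 * (2 * M) : ℕ) : ℝ) ∧
      2 * β * (1 + β) ^ k * (1 + Real.log (((2 * (2 * M) : ℕ) : ℝ))) ≤ ((2 * (2 * M) : ℕ) : ℝ) := by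
  have hβ128 : (128 : ℝ) ≤ β := by simpa [klBetaMin] using hβ
  have hβ0 : 0 < β := by linarith
  set b : ℝ := 1 + β with hb
  have hb1 : (129 : ℝ) ≤ b := by linarith
  -- `L ≥ 2¹⁰ b²`, `M ≥ 2¹⁰ b² (L+1)² ≥ 2³⁰ b⁶`
  have hceil : b ≤ (⌈|β|⌉₊ : ℝ) + 1 := by
    have h1 : β ≤ |β| := le_abs_self β
    have h2 : |β| ≤ (⌈|β|⌉₊ : ℝ) := Nat.le_ceil _
    linarith
  have hLr : (2 : ℝ) ^ 10 * b ^ 2 ≤ L := by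
    have h3 : ((2 ^ 10 * (⌈|β|⌉₊ + 1) ^ 2 * (⌈|U|⁻¹⌉₊ + 1) ^ 2 : ℕ) : ℝ) ≤ (L : ℝ) := by exact_mod_cast hL
    push_cast at h3
    have h4 : (1 : ℝ) ≤ ((⌈|U|⁻¹⌉₊ : ℝ) + 1) ^ 2 := by nlinarith [Nat.cast_nonneg (α := ℝ) ⌈|U|⁻¹⌉₊]
    have h5 : b ^ 2 ≤ ((⌈|β|⌉₊ : ℝ) + 1) ^ 2 := pow_le_pow_left₀ (by linarith) hceil 2
    nlinarith [mul_nonneg (by positivity : (0 : ℝ) ≤ 2 ^ 10 * ((⌈|β|⌉₊ : ℝ) + 1) ^ 2) (by linarith : (0 : ℝ) ≤ ((⌈|U|⁻¹⌉₊ : ℝ) + 1) ^ 2 - 1)]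
  have hMr : (2 : ℝ) ^ 30 * b ^ 6 ≤ M := by
    have h3 : ((2 ^ 10 * (⌈|β|⌉₊ + 1) ^ 2 * (L + 1) ^ 2 : ℕ) : ℝ) ≤ (M : ℝ) := by exact_mod_cast hM
    push_cast at h3
    have h5 : b ^ 2 ≤ ((⌈|β|⌉₊ : ℝ) + 1) ^ 2 := pow_le_pow_left₀ (by linarith) hceil 2
    have h6 : ((2 : ℝ) ^ 10 * b ^ 2) ^ 2 ≤ ((L : ℝ) + 1) ^ 2 := pow_le_pow_left₀ (by positivity) (by linarith) 2
    calc (2 : ℝ) ^ 30 * b ^ 6 = 2 ^ 10 * b ^ 2 * ((2 : ℝ) ^ 10 * b ^ 2) ^ 2 := by ring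
      _ ≤ 2 ^ 10 * ((⌈|β|⌉₊ : ℝ) + 1) ^ 2 * ((L : ℝ) + 1) ^ 2 := mul_le_mul (by nlinarith) h6 (by positivity) (by positivity)
      _ ≤ M := by linarith [h3]
  set Q : ℝ := (2 : ℝ) ^ 30 * b ^ 6 with hQ
  have hQpos : 0 < Q := by positivity
  have hN4 : (((2 * (2 * M) : ℕ) : ℝ)) = 4 * M := by push_cast; ring
  have hMQ : Q ≤ 4 * (M : ℝ) := by linarith
  have hb6 : (1 : ℝ) ≤ b ^ 6 := one_le_pow₀ (by linarith)
  have hbb6 : b ≤ b ^ 6 := le_self_pow₀ (by linarith) (by norm_num)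
  refine ⟨?_, ?_, ?_⟩
  · have h13 : (13 : ℝ) ≤ M := le_trans (by nlinarith) hMr
    have : 13 ≤ M := by exact_mod_cast h13
    omega
  · rw [hN4]
    have hM0 : (0 : ℝ) ≤ M := by positivity
    nlinarith
  · rw [hN4]
    have hNpos : (0 : ℝ) < 4 * M := by linarith
    -- `log 4M ≤ 4M/Q − 1 + log Q`, `log Q ≤ 21 + 6β`
    have hlog1 : Real.log (4 * M) ≤ 4 * M / Q - 1 + Real.log Q := by
      have h := Real.log_le_sub_one_of_pos (div_pos hNpos hQpos)
      rw [Real.log_div hNpos.ne' hQpos.ne'] at h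
      linarith
    have hlogQ : Real.log Q ≤ 21 + 6 * β := by
      rw [hQ, Real.log_mul (by positivity) (by positivity), Real.log_pow, Real.log_pow]
      have h2 := Real.log_two_lt_d9
      have hb' : Real.log b ≤ β := by
        have := Real.log_le_sub_one_of_pos (show 0 < b by linarith); rw [hb] at this ⊢; linarith
      push_cast
      nlinarith
    have hk4 : b ^ k ≤ b ^ 4 := pow_le_pow_right₀ (by linarith) hk
    have hbk0 : 0 ≤ b ^ k := by positivity
    -- `2βb^k(1 + log 4M) ≤ 2βb⁴(22b + 4M/Q) ≤ 44 b⁶ + 8M b⁵ β/Q ≤ 44Q/2³⁰ + 8M/2³⁰ ≤ 4M`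
    have hstep : 1 + Real.log (4 * M) ≤ 22 * b + 4 * M / Q := by rw [hb]; linarith
    have hstep0 : 0 ≤ 1 + Real.log (4 * M) := by
      have : 0 ≤ Real.log (4 * M) := Real.log_nonneg (by linarith)
      linarith
    have hM0 : (0 : ℝ) ≤ M := by positivity
    calc 2 * β * b ^ k * (1 + Real.log (4 * M)) ≤ 2 * β * b ^ 4 * (22 * b + 4 * M / Q) :=
          mul_le_mul (mul_le_mul_of_nonneg_left hk4 (by linarith)) hstep hstep0 (by positivity)
      _ = 44 * (β * b ^ 5) + 8 * M * (β * b ^ 4 / Q) := by ring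
      _ ≤ 44 * b ^ 6 + 8 * M * (1 / 2 ^ 30) := by
          have hb5 : 0 < b ^ 5 := by positivity
          have hb4 : 0 < b ^ 4 := by positivity
          have h1 : β * b ^ 5 ≤ b ^ 6 := by
            have : β ≤ b := by rw [hb]; linarith
            nlinarith
          have h2' : β * b ^ 4 ≤ b ^ 6 := by
            have : β ≤ b ^ 2 := by rw [hb]; nlinarith
            nlinarith
          have h2 : β * b ^ 4 / Q ≤ 1 / 2 ^ 30 := by
            rw [div_le_div_iff₀ hQpos (by positivity), one_mul, hQ]
            linarith
          have h3 := mul_le_mul_of_nonneg_left h2 (show (0 : ℝ) ≤ 8 * M by positivity)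
          linarith
      _ ≤ 4 * M := by
          have : 44 * b ^ 6 = 44 / 2 ^ 30 * Q := by rw [hQ]; ring
          rw [this]
          linarith

/-- **`hrow` UNDER THE ENGINE'S BINDERS** (`μ ∈ klWindowC`, `klBetaMin ≤ β`, `klEngL₃ β U ≤ L`, `klEngM₃ β U L ≤ M`; `k ≤ 4`; `ℓ > 0`, `0 ≤ λ ≤ 1`, `λℓ ≤ 1`):
`Σ_Y ‖C X Y‖·wt_{λ,k}{X,Y} ≤ a_k(ℓ)·(2(2M))/β` with the `a_k(ℓ)` of `rowSum_scaleZero_weighted_le_size`. -/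
theorem rowSum_scaleZero_weighted_le_klEng {μ : ℝ} (hμ : μ ∈ klWindowC) {β U : ℝ} (hβ : klBetaMin ≤ β) (hL : klEngL₃ β U ≤ L)
    (hM : EngineV8.klEngM₃ β U L ≤ M) {k : ℕ} (hk : k ≤ 4) {ℓ : ℝ} (hℓ : 0 < ℓ) {lam : ℝ} (hlam0 : 0 ≤ lam) (hlam1 : lam ≤ 1) (hlamℓ : lam * ℓ ≤ 1)
    (X : GridLeg (GridPoint L (2 * (2 * M)))) :
    let Aon : ℕ → ℝ := fun i => klChi2CauchyTab (k + 2) * (i + 1) ! * 2 ^ (i + 1)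
    let Aoff : ℕ → ℝ := fun i => (k + 4) ! * klChi2CauchyTab (i + (k + 4)) * (i + (k + 4) + 1) ! * 2 ^ (i + 2) * (2 / klE0) *
      (max 1 (4 / klE0)) ^ (k + 4 - 1) * 8 ^ (k + 4) * (1 + (4 : ℝ) ^ (k + 4) * ∑' q : Site 2, ((1 + ‖q‖) ^ (k + 4))⁻¹)
    let Goff : ℝ := 4 * ((k + 4) ! * klChi2CauchyTab (k + 4) * (k + 4 + 1) ! * (max 1 (4 / klE0)) ^ (k + 4 - 1) * 8 ^ (k + 4) *
      (1 + (4 : ℝ) ^ (k + 4) * ∑' q : Site 2, ((1 + ‖q‖) ^ (k + 4))⁻¹)) * (2 / klE0)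
    let EDon : ℝ := ∑ i ∈ Finset.range (k + 2), 2 * ((max i 1 : ℕ) : ℝ) * 2 ^ i * Aon i / π
    let EDoff : ℝ := ∑ i ∈ Finset.range (k + 2), 2 * ((max i 1 : ℕ) : ℝ) * 2 ^ i * Aoff i / π
    let Gon' : ℝ := max 16 ((k + 2 : ℕ) * Aon (k + 2) * (π / klE0) ^ (k + 2) / ℓ ^ (k + 2)) * 2 ^ (k + 2)
    let Goff' : ℝ := max Goff ((k + 2 : ℕ) * Aoff (k + 2) * (π / klE0) ^ (k + 2) / ℓ ^ (k + 2)) * 2 ^ (k + 2)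
    let a : ℝ := (EDon + EDoff * ∑' z : Site 2, ((1 + ‖z‖) ^ 4)⁻¹) + 2 * (1 + ℓ) * (Gon' + Goff' * ∑' z : Site 2, ((1 + ‖z‖) ^ 4)⁻¹)
    ∑ Y : GridLeg (GridPoint L (2 * (2 * M))),
        ‖((hubbardGridSub L M β (2 * (2 * M))).transpose * hubbardCovAboveCT L M β μ 0 0 klE0 * hubbardGridSub L M β (2 * (2 * M))) X Y‖ *
          diamWeight (fun s => (1 + lam * s) ^ k) (gridLabelDist L (2 * (2 * M)) β) {gridLegPos X, gridLegPos Y} ≤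
      a * ((2 * (2 * M) : ℕ) : ℝ) / β := by
  obtain ⟨hM', hβN, hlog⟩ := weightedSize_sideConditions_of_klEng (L := L) (M := M) hβ hL hM hk
  exact rowSum_scaleZero_weighted_le_size hμ hβ hL k hM' hβN hlog hℓ hlam0 hlam1 hlamℓ X

/-- **`hcol` UNDER THE ENGINE'S BINDERS.** -/
theorem colSum_scaleZero_weighted_le_klEng {μ : ℝ} (hμ : μ ∈ klWindowC) {β U : ℝ} (hβ : klBetaMin ≤ β) (hL : klEngL₃ β U ≤ L)
    (hM : EngineV8.klEngM₃ β U L ≤ M) {k : ℕ} (hk : k ≤ 4) {ℓ : ℝ} (hℓ : 0 < ℓ) {lam : ℝ} (hlam0 : 0 ≤ lam) (hlam1 : lam ≤ 1) (hlamℓ : lam * ℓ ≤ 1)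
    (Y : GridLeg (GridPoint L (2 * (2 * M)))) :
    let Aon : ℕ → ℝ := fun i => klChi2CauchyTab (k + 2) * (i + 1) ! * 2 ^ (i + 1)
    let Aoff : ℕ → ℝ := fun i => (k + 4) ! * klChi2CauchyTab (i + (k + 4)) * (i + (k + 4) + 1) ! * 2 ^ (i + 2) * (2 / klE0) *
      (max 1 (4 / klE0)) ^ (k + 4 - 1) * 8 ^ (k + 4) * (1 + (4 : ℝ) ^ (k + 4) * ∑' q : Site 2, ((1 + ‖q‖) ^ (k + 4))⁻¹)
    let Goff : ℝ := 4 * ((k + 4) ! * klChi2CauchyTab (k + 4) * (k + 4 + 1) ! * (max 1 (4 / klE0)) ^ (k + 4 - 1) * 8 ^ (k + 4) *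
      (1 + (4 : ℝ) ^ (k + 4) * ∑' q : Site 2, ((1 + ‖q‖) ^ (k + 4))⁻¹)) * (2 / klE0)
    let EDon : ℝ := ∑ i ∈ Finset.range (k + 2), 2 * ((max i 1 : ℕ) : ℝ) * 2 ^ i * Aon i / π
    let EDoff : ℝ := ∑ i ∈ Finset.range (k + 2), 2 * ((max i 1 : ℕ) : ℝ) * 2 ^ i * Aoff i / π
    let Gon' : ℝ := max 16 ((k + 2 : ℕ) * Aon (k + 2) * (π / klE0) ^ (k + 2) / ℓ ^ (k + 2)) * 2 ^ (k + 2)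
    let Goff' : ℝ := max Goff ((k + 2 : ℕ) * Aoff (k + 2) * (π / klE0) ^ (k + 2) / ℓ ^ (k + 2)) * 2 ^ (k + 2)
    let a : ℝ := (EDon + EDoff * ∑' z : Site 2, ((1 + ‖z‖) ^ 4)⁻¹) + 2 * (1 + ℓ) * (Gon' + Goff' * ∑' z : Site 2, ((1 + ‖z‖) ^ 4)⁻¹)
    ∑ X : GridLeg (GridPoint L (2 * (2 * M))),
        ‖((hubbardGridSub L M β (2 * (2 * M))).transpose * hubbardCovAboveCT L M β μ 0 0 klE0 * hubbardGridSub L M β (2 * (2 * M))) X Y‖ *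
          diamWeight (fun s => (1 + lam * s) ^ k) (gridLabelDist L (2 * (2 * M)) β) {gridLegPos X, gridLegPos Y} ≤
      a * ((2 * (2 * M) : ℕ) : ℝ) / β := by
  obtain ⟨hM', hβN, hlog⟩ := weightedSize_sideConditions_of_klEng (L := L) (M := M) hβ hL hM hk
  exact colSum_scaleZero_weighted_le_size hμ hβ hL k hM' hβN hlog hℓ hlam0 hlam1 hlamℓ Y

end Summit.HubbardSuperconductivity.HubbardSuperconductivity.Theorems.KLRegimeSplit

end
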